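import Summits.HodgeConjecture.HodgeConjecture.Theorems.R90S8ResidualDefs                 -- ★ `R90S8ResidualDefs.charLine₂` (the character lines `ℂ·[ψ∘det]` of `U(Φ₂)`)
import Literature.NumberTheory.Automorphic.UnitaryGroupDetCharacterSection                -- ★ `cm_exists_eq_cmDetChar_antidiagOne_two` (every automorphic character of `U(Φ₂)(𝔸)` is `ψ∘det`)
import Literature.NumberTheory.Automorphic.AutomorphicCharacterLine                       -- ★ `AutomorphicCharacter.toL2`, `coeFn_toL2`, `lineSubrep`, `mem_lineSubrep_iff`
import HarnessLib

/-!
# K2·E1 ∕ R90·S8 — `K2E1SelfDualResidueAtomMemCharLineCMTwo`: AN `L²` CLASS WHOSE REPRESENTATIVE IS `x ↦ r·Θ((out x)⁻¹)` LIES ON THE CHARACTER LINE OF `Θ⁻¹`,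
# HENCE IN `⨆_ψ charLine₂ ψ` — the `L²` end of the (L-SD) letter «the residue atom of a self-dual `χ`-family at the top pole is `c·(ψ∘det)`»

Track B ∕ K2-LIT, crux h413 = `stmt-HodgeConjecture-24833`, route of record `HCCMUnconditional`; cell `hodgecm-mathlib`, R90-TF section S8 «ContSpec-n½» (R90-CS-plan (g0) deal (B)
2026-09-04T16:23:19Z → K2E2-p12 (g8); consumer: K2E1-p15 (g3)'s LAYER 1∕2 `R90S8LeClosureOfBlockLetters` ∕ `R90S8ResHLeClosureCharLinesOfLetters`, letter (L)).  THEOREMS ONLY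
(no `def`, no `instance`, no notation, no named-fact hypothesis, no `sorry`; default heartbeats); lane `--supports stmt-HodgeConjecture-24833 --as helper` (count-neutral).

THE MATHEMATICS ([MoeglinWaldspurger1995, IV.1.11]; [Rogawski1990, §13.3 p. 202, §13.9 (i)]; [Gelbart1975, §2.A]).  On `U(Φ₂) = U(1,1)_{L∕L⁺}` the residues of the continued
Borel Eisenstein families at the top pole `z = 1` are the functions `g ↦ r·Θ(g)` with `Θ = ψ ∘ det` an automorphic character (T2 FINAL ★ `K2E1EisensteinResidueLevelConstantU2Final.
residue_detTwist_eq_const_mul_level_cm_two`: «`∀ g, Fp′ g 1 = r * Θ g`»); the E1 estate reads residues as `L²` CLASSES on the automorphic quotient through the `out⁻¹` convention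
(`Res =ᵐ x ↦ Fp (out x)⁻¹ 1 − …`, ★ T2 (L-AE)).  This file is the DICTIONARY between the two currencies and the S8 socket's lattice:
* §1 (any adelic datum `𝒢`) **`eq_smul_toL2_inv_of_ae_eq`** — if `f ∈ L²(𝒢(K)A_𝒢\𝒢(𝔸), μ)` is a.e. `x ↦ r·Θ((out x)⁻¹)` for an automorphic character `Θ`, then `f = r • [Θ⁻¹]` (`Θ(g⁻¹) = Θ⁻¹(g)`,
  ★ `coeFn_toL2`), hence `f ∈ Θ⁻¹.lineSubrep μ` (`mem_lineSubrep_inv_of_ae_eq`).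
* §2 (`U(Φ₂)` over a CM field) **`mem_iSup_charLine₂_of_ae_eq`** — such an `f` lies in `⨆ ψ : {ψ ∕∕ automorphic}, (charLine₂ L ψ.1 ψ.2 μ₂).toSubmodule` (the S8 socket #4′ lattice, subtype-indexed
  as ruled (S1) 16:25:37Z): `Θ⁻¹ = ψ′ ∘ det` for an automorphic `ψ′` of `U(1)` (★ `cm_exists_eq_cmDetChar_antidiagOne_two`); and the pointwise-residue form
  **`mem_iSup_charLine₂_of_ae_eq_residue`** taking T2 FINAL's conclusion `hres : ∀ g, F g = r * Θ g` and the (L-AE)-type identification `f =ᵐ x ↦ F ((out x)⁻¹)` as its two inputs.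
HONEST LABEL: HC_CM is proved only modulo the 7 printed citations (2 remaining named inputs: hLiu418 = `stmt-HodgeConjecture-24832`, h413 = `stmt-HodgeConjecture-24833`) until rung 0
closes; count-neutral helper; closes no socket (it pays the `L²`-end of the (L-SD) letter; the χ₀-dichotomy and the atom identification are separate files).

## References
* [MoeglinWaldspurger1995] C. Mœglin, J.-L. Waldspurger, *Spectral Decomposition and Eisenstein Series* (1995), IV.1.11 (residues of rank-one Eisenstein series).
* [Rogawski1990] J. D. Rogawski, *Automorphic Representations of Unitary Groups in Three Variables* (1990), §13.3 p. 202 (`χ ∘ det`), §13.9 (i) p. 229.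
* [Gelbart1975] S. Gelbart, *Automorphic forms on adele groups* (1975), §2.A (character lines in `L²`).
-/

set_option autoImplicit false
-- the mandated namespace repeats the single-problem summit's segment (`HodgeConjecture.HodgeConjecture`)
set_option linter.dupNamespace false

noncomputable section

open MeasureTheory NumberField IsDedekindDomain
open Literature.NumberTheory.Automorphic Literature.NumberTheory.Automorphic.UnitaryGroup AdelicGroupData
open Literature.NumberTheory.Automorphic.Arthur2013.Leaves.TECR
open Summit.HodgeConjecture.HodgeConjecture.Cruxes.H413.R90S8ResidualDefs (charLine₂)

namespace Summit.HodgeConjecture.HodgeConjecture.Cruxes.H413.K2E1SelfDualResidueAtomMemCharLineCMTwo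

universe u

/-! ## §1 Any adelic datum: an `L²` class a.e. equal to `x ↦ r·Θ((out x)⁻¹)` is `r • [Θ⁻¹]` -/

section Generic

variable {K : Type} [Field K] [NumberField K] {𝒢 : AdelicGroupData.{u} K} (Θ : 𝒢.AutomorphicCharacter)
  (μ : Measure 𝒢.automorphicQuotient) [𝒢.IsAutomorphicMeasure μ]

/-- `Θ((out x)⁻¹) = [Θ⁻¹](x)`: the `out⁻¹`-representative of the character `Θ` IS the descended function of `Θ⁻¹`. [cite: Gelbart1975, §2.A] -/
theorem coe_apply_out_inv_eq_quotientFun_inv (x : 𝒢.automorphicQuotient) :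
    ((Θ (Quotient.out (x : 𝒢.Adelic ⧸ 𝒢.quotientSubgroup))⁻¹ : ℂˣ) : ℂ) = Θ⁻¹.quotientFun x := by
  have hx : 𝒢.toAutomorphicQuotient (Quotient.out (x : 𝒢.Adelic ⧸ 𝒢.quotientSubgroup)) = x := Quotient.out_eq _
  conv_rhs => rw [← hx, AutomorphicCharacter.quotientFun_toAutomorphicQuotient, AutomorphicCharacter.coe_inv_apply]
  rw [map_inv, Units.val_inv_eq_inv_val]

/-- **An `L²` class a.e. equal to `x ↦ r·Θ((out x)⁻¹)` is `r • [Θ⁻¹]`.** [cite: Gelbart1975, §2.A] [cite: MoeglinWaldspurger1995, IV.1.11] -/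
theorem eq_smul_toL2_inv_of_ae_eq (r : ℂ) {f : 𝒢.L2 μ}
    (hf : (f : 𝒢.automorphicQuotient → ℂ) =ᵐ[μ] fun x => r * ((Θ (Quotient.out (x : 𝒢.Adelic ⧸ 𝒢.quotientSubgroup))⁻¹ : ℂˣ) : ℂ)) :
    f = r • Θ⁻¹.toL2 μ := by
  refine Lp.ext ?_
  filter_upwards [hf, Lp.coeFn_smul r (Θ⁻¹.toL2 μ), Θ⁻¹.coeFn_toL2 μ] with x h1 h2 h3
  rw [h1, h2, Pi.smul_apply, h3, smul_eq_mul, coe_apply_out_inv_eq_quotientFun_inv]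

/-- … hence it lies on the character line of `Θ⁻¹`. [cite: Gelbart1975, §2.A] -/
theorem mem_lineSubrep_inv_of_ae_eq (r : ℂ) {f : 𝒢.L2 μ}
    (hf : (f : 𝒢.automorphicQuotient → ℂ) =ᵐ[μ] fun x => r * ((Θ (Quotient.out (x : 𝒢.Adelic ⧸ 𝒢.quotientSubgroup))⁻¹ : ℂˣ) : ℂ)) :
    f ∈ Θ⁻¹.lineSubrep μ :=
  (Θ⁻¹.mem_lineSubrep_iff μ f).2 ⟨r, (eq_smul_toL2_inv_of_ae_eq Θ μ r hf).symm⟩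

/-- The POINTWISE-RESIDUE form: `F g = r·Θ(g)` for all `g` (T2 FINAL's conclusion shape) and `f =ᵐ x ↦ F((out x)⁻¹)` (the (L-AE) identification shape) give `f = r • [Θ⁻¹]`.
[cite: MoeglinWaldspurger1995, IV.1.11] [cite: Gelbart1975, §2.A] -/
theorem eq_smul_toL2_inv_of_ae_eq_residue {F : 𝒢.Adelic → ℂ} {r : ℂ} (hres : ∀ g, F g = r * ((Θ g : ℂˣ) : ℂ)) {f : 𝒢.L2 μ}
    (hf : (f : 𝒢.automorphicQuotient → ℂ) =ᵐ[μ] fun x => F (Quotient.out (x : 𝒢.Adelic ⧸ 𝒢.quotientSubgroup))⁻¹) :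
    f = r • Θ⁻¹.toL2 μ :=
  eq_smul_toL2_inv_of_ae_eq Θ μ r (hf.trans (Filter.Eventually.of_forall fun _ => hres _))

end Generic

/-! ## §2 `U(Φ₂)` over a CM field: such a class lies in `⨆_ψ charLine₂ ψ` (the S8 #4′ lattice) -/

section CM

variable (L : Type) [Field L] [NumberField L] [IsCMField L]
  (μ₂ : Measure (UnitaryGroup.cmDatum L 2 (Matrix.of fun i j : Fin 2 => if i.val + j.val + 1 = 2 then (1 : L) else 0)).automorphicQuotient)
  [(UnitaryGroup.cmDatum L 2 (Matrix.of fun i j : Fin 2 => if i.val + j.val + 1 = 2 then (1 : L) else 0)).IsAutomorphicMeasure μ₂]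

/-- **AN `L²` CLASS A.E. EQUAL TO `x ↦ r·Θ((out x)⁻¹)`, `Θ` ANY AUTOMORPHIC CHARACTER OF `U(Φ₂)(𝔸)`, LIES IN `⨆_ψ charLine₂ ψ`** (subtype-indexed, the #4′ socket's lattice):
`Θ⁻¹ = ψ′ ∘ det` for an automorphic `ψ′` (★ `cm_exists_eq_cmDetChar_antidiagOne_two`) and `f = r • [Θ⁻¹] ∈ charLine₂ ψ′`. [cite: Rogawski1990, §13.3 p. 202] [cite: Gelbart1975, §2.A] -/
theorem mem_iSup_charLine₂_of_ae_eq
    (Θ : (UnitaryGroup.cmDatum L 2 (Matrix.of fun i j : Fin 2 => if i.val + j.val + 1 = 2 then (1 : L) else 0)).AutomorphicCharacter) (r : ℂ)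
    {f : (UnitaryGroup.cmDatum L 2 (Matrix.of fun i j : Fin 2 => if i.val + j.val + 1 = 2 then (1 : L) else 0)).L2 μ₂}
    (hf : (f : (UnitaryGroup.cmDatum L 2 (Matrix.of fun i j : Fin 2 => if i.val + j.val + 1 = 2 then (1 : L) else 0)).automorphicQuotient → ℂ) =ᵐ[μ₂]
      fun x => r * ((Θ (Quotient.out (x : (UnitaryGroup.cmDatum L 2 (Matrix.of fun i j : Fin 2 => if i.val + j.val + 1 = 2 then (1 : L) else 0)).Adelic ⧸
        (UnitaryGroup.cmDatum L 2 (Matrix.of fun i j : Fin 2 => if i.val + j.val + 1 = 2 then (1 : L) else 0)).quotientSubgroup))⁻¹ : ℂˣ) : ℂ)) :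
    f ∈ ⨆ ψ : {ψ : ↥(TorusDict.torus (IsCMField.complexConj L)) →ₜ* ℂˣ // TorusDict.IsAutomorphic (IsCMField.complexConj L) ψ},
      (charLine₂ L ψ.1 ψ.2 μ₂).toSubmodule := by
  obtain ⟨θ, hθ, hΘθ⟩ := cm_exists_eq_cmDetChar_antidiagOne_two L Θ⁻¹
  have hmem : f ∈ (charLine₂ L θ hθ μ₂).toSubmodule := by
    change f ∈ (AdelicGroupData.AutomorphicCharacter.lineSubrep
      (𝒢 := UnitaryGroup.cmDatum L 2 (Matrix.of fun i j : Fin 2 => if i.val + j.val + 1 = 2 then (1 : L) else 0))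
      (cmDetChar L 2 (Matrix.of fun i j : Fin 2 => if i.val + j.val + 1 = 2 then (1 : L) else 0) θ hθ (isUnit_antidiagOne_det L 2).ne_zero) μ₂).toSubmodule
    rw [hΘθ]
    exact mem_lineSubrep_inv_of_ae_eq Θ μ₂ r hf
  exact Submodule.mem_iSup_of_mem ⟨θ, hθ⟩ hmem

/-- **THE POINTWISE-RESIDUE FORM at `U(Φ₂)`**: from T2 FINAL's conclusion `hres : ∀ g, F g = r * Θ g` (★ `residue_detTwist_eq_const_mul_level_cm_two`, `Θ = ψ∘det`) and the (L-AE)-type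
identification `f =ᵐ x ↦ F((out x)⁻¹)` of an `L²` residue class, `f ∈ ⨆_ψ charLine₂ ψ`. [cite: MoeglinWaldspurger1995, IV.1.11] [cite: Rogawski1990, §13.3 p. 202] -/
theorem mem_iSup_charLine₂_of_ae_eq_residue
    (Θ : (UnitaryGroup.cmDatum L 2 (Matrix.of fun i j : Fin 2 => if i.val + j.val + 1 = 2 then (1 : L) else 0)).AutomorphicCharacter)
    {F : (UnitaryGroup.cmDatum L 2 (Matrix.of fun i j : Fin 2 => if i.val + j.val + 1 = 2 then (1 : L) else 0)).Adelic → ℂ} {r : ℂ}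
    (hres : ∀ g, F g = r * ((Θ g : ℂˣ) : ℂ))
    {f : (UnitaryGroup.cmDatum L 2 (Matrix.of fun i j : Fin 2 => if i.val + j.val + 1 = 2 then (1 : L) else 0)).L2 μ₂}
    (hf : (f : (UnitaryGroup.cmDatum L 2 (Matrix.of fun i j : Fin 2 => if i.val + j.val + 1 = 2 then (1 : L) else 0)).automorphicQuotient → ℂ) =ᵐ[μ₂]
      fun x => F (Quotient.out (x : (UnitaryGroup.cmDatum L 2 (Matrix.of fun i j : Fin 2 => if i.val + j.val + 1 = 2 then (1 : L) else 0)).Adelic ⧸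
        (UnitaryGroup.cmDatum L 2 (Matrix.of fun i j : Fin 2 => if i.val + j.val + 1 = 2 then (1 : L) else 0)).quotientSubgroup))⁻¹) :
    f ∈ ⨆ ψ : {ψ : ↥(TorusDict.torus (IsCMField.complexConj L)) →ₜ* ℂˣ // TorusDict.IsAutomorphic (IsCMField.complexConj L) ψ},
      (charLine₂ L ψ.1 ψ.2 μ₂).toSubmodule :=
  mem_iSup_charLine₂_of_ae_eq L μ₂ Θ r (hf.trans (Filter.Eventually.of_forall fun _ => hres _))

/-- **SPAN FORM** (for an `At` defined as the span of residue classes): if every member of a set `S ⊆ L²` is a.e. `x ↦ r_f·Θ_f((out x)⁻¹)` for some automorphic character `Θ_f` and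
scalar `r_f`, then `span S ≤ ⨆_ψ charLine₂ ψ`. [cite: Rogawski1990, §13.3 p. 202] [cite: MoeglinWaldspurger1995, IV.1.11] -/
theorem span_le_iSup_charLine₂_of_forall_ae_eq
    (S : Set ((UnitaryGroup.cmDatum L 2 (Matrix.of fun i j : Fin 2 => if i.val + j.val + 1 = 2 then (1 : L) else 0)).L2 μ₂))
    (hS : ∀ f ∈ S, ∃ (Θ : (UnitaryGroup.cmDatum L 2 (Matrix.of fun i j : Fin 2 => if i.val + j.val + 1 = 2 then (1 : L) else 0)).AutomorphicCharacter) (r : ℂ),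
      (f : (UnitaryGroup.cmDatum L 2 (Matrix.of fun i j : Fin 2 => if i.val + j.val + 1 = 2 then (1 : L) else 0)).automorphicQuotient → ℂ) =ᵐ[μ₂]
        fun x => r * ((Θ (Quotient.out (x : (UnitaryGroup.cmDatum L 2 (Matrix.of fun i j : Fin 2 => if i.val + j.val + 1 = 2 then (1 : L) else 0)).Adelic ⧸
          (UnitaryGroup.cmDatum L 2 (Matrix.of fun i j : Fin 2 => if i.val + j.val + 1 = 2 then (1 : L) else 0)).quotientSubgroup))⁻¹ : ℂˣ) : ℂ)) :
    Submodule.span ℂ S ≤ ⨆ ψ : {ψ : ↥(TorusDict.torus (IsCMField.complexConj L)) →ₜ* ℂˣ // TorusDict.IsAutomorphic (IsCMField.complexConj L) ψ},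
      (charLine₂ L ψ.1 ψ.2 μ₂).toSubmodule :=
  Submodule.span_le.2 fun f hf => by
    obtain ⟨Θ, r, h⟩ := hS f hf
    exact mem_iSup_charLine₂_of_ae_eq L μ₂ Θ r h

end CM

end Summit.HodgeConjecture.HodgeConjecture.Cruxes.H413.K2E1SelfDualResidueAtomMemCharLineCMTwo

end
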